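import Literature.RepresentationTheory.HeisenbergGroup.MetaplecticSumStripping
import HarnessLib

/-!
# Sum-stripping for the RIGHT summand and box implementers: `S̃p_ψ(W_{T₂}) → S̃p_ψ(W_T)` along `g₂ ↦ 1 ⊕ g₂`,
# and the implementers of `g₁ ⊕ g₂` are `c · (M₁ ⊠ M₂)`

Topic `RepresentationTheory/HeisenbergGroup`; namespace `Literature.RepresentationTheory.HeisenbergGroup`. KERNEL
MATHEMATICS ONLY (definitions with bodies + theorems; no named fact, no `axiom`, no `sorry`). The mirror image of
`SchrodingerDirectSum` §2 and `MetaplecticSumStripping` §2 for the SECOND summand of `W_T = W_{T₁} ⊕ W_{T₂}`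
(`T = reindex e e (T₁ ⊕ T₂)`), plus the «box implementers» lemma of the see-saw / doubling formalism
[MoeglinVignerasWaldspurger1987, Chap. 2 II.1 Rem. (6); Kudla1984, §1]:

* §0 algebra: `exists_tmul_eq_of_commute_rTensor` (the commutant of `S ⊗ 1` is `1 ⊗ End W` when `S` has scalar
  commutant — the tree's `LinearAlgebra.exists_tmul_eq_of_commute_lTensor` transported along `TensorProduct.comm`),
  `boxSB_right_cancel` (`f₁ ⊠ f₂ = f₁ ⊠ f₂'`, `f₁ ≠ 0` ⇒ `f₂ = f₂'`);
* §1 `inrW g₂ = 1 ⊕ g₂` (through `e`), **`spInr : Sp(W_{T₂}) →* Sp(W_T)`**, and for Weil's section `ofSymplectic`: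
  `(1 ⊕ g₂) · inrH h₂ = inrH (g₂ · h₂)` (`act_spInr_inrH`), `(1 ⊕ g₂) · inlH h₁ = inlH h₁` (`act_spInr_inlH`); the two
  embeddings commute (`spInl_mul_spInr_comm`);
* §2 **right stripping** (`exists_strip_boxSB_right`, `exists_strip_of_proj_eq_spInr`, `strip_unique_right`): for
  `(G, M) ∈ S̃p_ψ(W_T)` over `G = 1 ⊕ g₂` there is `(g₂, M₂) ∈ S̃p_ψ(W_{T₂})` with `M (f₁ ⊠ f₂) = f₁ ⊠ M₂ f₂`, unique
  (`det T₁` a unit: Schur for `ρ_{T₁}`);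
* §3 **box implementers** (`implements_of_boxSB`, `exists_smul_boxSB_of_implements_mul`): if `(g₁, M₁) ∈ S̃p_ψ(W_{T₁})`
  and `(g₂, M₂) ∈ S̃p_ψ(W_{T₂})`, then `M₁ ⊠ M₂` implements `(g₁ ⊕ 1)(1 ⊕ g₂)` for `ρ_T`, and EVERY implementer `M` of it
  is `M (f₁ ⊠ f₂) = c · (M₁ f₁ ⊠ M₂ f₂)` for a unit `c` (`det T₁`, `det T₂` units: implementers of `ρ_T` are unique up
  to scalars, `implementerUniqueUpToScalar_schrodingerSB_gram`, with `det T = det T₁ · det T₂`).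

## References
* [MoeglinVignerasWaldspurger1987] C. Mœglin, M.-F. Vignéras, J.-L. Waldspurger, LNM 1291 (1987), Chap. 2 I.3, II.1
  (A), Rem. (6).
* [Kudla1984] S. Kudla, *Seesaw dual reductive pairs*, Progr. Math. 46 (1984), §1.
* [Weil1964] A. Weil, *Sur certains groupes d'opérateurs unitaires*, Acta Math. 111 (1964), n° 5, n° 37–38.
-/

set_option autoImplicit false

noncomputable section

open scoped TensorProduct

namespace Literature.RepresentationTheory.HeisenbergGroup

open Literature.NumberTheory.Automorphic
open Literature.NumberTheory.GaloisRepresentations.IsNonarchimedeanLocalField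

/-! ## §0 Algebra: the commutant of `S ⊗ 1`; `f₁ ⊠`-cancellation -/

section TensorAlgebra

variable {k : Type*} [Field k] {V W : Type*} [AddCommGroup V] [Module k V] [AddCommGroup W] [Module k W]

/-- **The commutant of `S ⊗ 1` is `1 ⊗ End(W)` when `S ⊆ End(V)` has scalar commutant**: an endomorphism `T` of
`V ⊗ W` commuting with `s ⊗ id` for all `s ∈ S` is `v ⊗ w ↦ v ⊗ B w` for a linear `B : W → W` (the tree's
`exists_tmul_eq_of_commute_lTensor` transported along `TensorProduct.comm`).
[cite: MoeglinVignerasWaldspurger1987, Chap. 2 II.1 Rem. (6)] -/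
theorem exists_tmul_eq_of_commute_rTensor {S : Set (V →ₗ[k] V)}
    (hS : ∀ f : V →ₗ[k] V, (∀ s ∈ S, f ∘ₗ s = s ∘ₗ f) → ∃ c : k, f = c • LinearMap.id)
    (T : V ⊗[k] W →ₗ[k] V ⊗[k] W) (hT : ∀ s ∈ S, T ∘ₗ LinearMap.rTensor W s = LinearMap.rTensor W s ∘ₗ T) :
    ∃ B : W →ₗ[k] W, ∀ (v : V) (w : W), T (v ⊗ₜ w) = v ⊗ₜ B w := by
  let T' : W ⊗[k] V →ₗ[k] W ⊗[k] V :=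
    (TensorProduct.comm k V W).toLinearMap ∘ₗ T ∘ₗ (TensorProduct.comm k W V).toLinearMap
  have hcomm : ∀ (s : V →ₗ[k] V) (z : W ⊗[k] V),
      (TensorProduct.comm k W V) (LinearMap.lTensor W s z) = LinearMap.rTensor W s ((TensorProduct.comm k W V) z) := by
    intro s z
    induction z using TensorProduct.induction_on with
    | zero => simp
    | tmul w v => rw [LinearMap.lTensor_tmul, TensorProduct.comm_tmul, TensorProduct.comm_tmul, LinearMap.rTensor_tmul]
    | add x y hx hy => rw [map_add, map_add, hx, hy, map_add, map_add]
  have hcomm' : ∀ (s : V →ₗ[k] V) (z : V ⊗[k] W),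
      (TensorProduct.comm k V W) (LinearMap.rTensor W s z) = LinearMap.lTensor W s ((TensorProduct.comm k V W) z) := by
    intro s z
    induction z using TensorProduct.induction_on with
    | zero => simp
    | tmul v w => rw [LinearMap.rTensor_tmul, TensorProduct.comm_tmul, TensorProduct.comm_tmul, LinearMap.lTensor_tmul]
    | add x y hx hy => rw [map_add, map_add, hx, hy, map_add, map_add]
  have hT' : ∀ s ∈ S, T' ∘ₗ LinearMap.lTensor W s = LinearMap.lTensor W s ∘ₗ T' := by
    intro s hs
    refine LinearMap.ext fun z => ?_
    change (TensorProduct.comm k V W) (T ((TensorProduct.comm k W V) (LinearMap.lTensor W s z))) =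
      LinearMap.lTensor W s ((TensorProduct.comm k V W) (T ((TensorProduct.comm k W V) z)))
    rw [hcomm, ← LinearMap.comp_apply (f := T), hT s hs, LinearMap.comp_apply, hcomm']
  obtain ⟨B, hB⟩ := Literature.LinearAlgebra.exists_tmul_eq_of_commute_lTensor hS T' hT'
  refine ⟨B, fun v w => ?_⟩
  have h := hB w v
  change (TensorProduct.comm k V W) (T ((TensorProduct.comm k W V) (w ⊗ₜ v))) = B w ⊗ₜ v at h
  rw [TensorProduct.comm_tmul] at h
  have h' := congrArg (TensorProduct.comm k V W).symm h
  rw [LinearEquiv.symm_apply_apply, TensorProduct.comm_symm_tmul] at h'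
  exact h'

end TensorAlgebra

section Cancel

variable (K : Type*) [Field K] [ValuativeRel K] [TopologicalSpace K] [IsNonarchimedeanLocalField K]
  {ι₁ ι₂ ι : Type*} [Fintype ι₁] [Fintype ι₂] [Fintype ι] (e : ι₁ ⊕ ι₂ ≃ ι)

/-- **`f₁ ⊠`-cancellation**: `f₁ ⊠ f₂ = f₁ ⊠ f₂'` with `f₁ ≠ 0` forces `f₂ = f₂'` (read at a point where `f₁ ≠ 0`).
[cite: MoeglinVignerasWaldspurger1987, Chap. 2 II.1 Rem. (6)] -/
theorem boxSB_right_cancel {f₁ : SchwartzBruhat (ι₁ → K)} (hf₁ : f₁ ≠ 0) {f₂ f₂' : SchwartzBruhat (ι₂ → K)}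
    (h : boxSB K e f₁ f₂ = boxSB K e f₁ f₂') : f₂ = f₂' := by
  have hne : ((f₁ : SchwartzBruhat (ι₁ → K)) : (ι₁ → K) → ℂ) ≠ 0 := fun h0 =>
    hf₁ (Subtype.ext (h0.trans (Submodule.coe_zero (R := ℂ) (M := (ι₁ → K) → ℂ)).symm))
  obtain ⟨a, ha⟩ := Function.ne_iff.1 hne
  apply Subtype.ext
  funext b
  have := congrArg (fun Ψ : SchwartzBruhat (ι → K) => ((Ψ : SchwartzBruhat (ι → K)) : (ι → K) → ℂ) (glue e a b)) h
  simp only [boxSB_apply_glue] at this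
  exact mul_left_cancel₀ ha this

end Cancel

/-! ## §1 `1 ⊕ g₂` and the embedding `spInr : Sp(W_{T₂}) →* Sp(W_T)` -/

section Blocks

variable {K : Type*} [CommRing K] {ι₁ ι₂ ι : Type*} (e : ι₁ ⊕ ι₂ ≃ ι)

local notation "𝕎" => ((ι → K) × (ι → K))
local notation "𝕎₁" => ((ι₁ → K) × (ι₁ → K))
local notation "𝕎₂" => ((ι₂ → K) × (ι₂ → K))

/-- `1 ⊕ g₂` as a linear automorphism of `W_T` (through `e`). [cite: Kudla1984, §1] -/
def inrW (g₂ : 𝕎₂ ≃ₗ[K] 𝕎₂) : 𝕎 ≃ₗ[K] 𝕎 :=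
  (splitW e).trans (((LinearEquiv.refl K 𝕎₁).prodCongr g₂).trans (splitW e).symm)

/-- formula: `(1 ⊕ g₂)(x, y) = (x|₁ ⊔ (g₂(x|₂, y|₂)).1, y|₁ ⊔ (g₂(x|₂, y|₂)).2)`. [cite: Kudla1984, §1] -/
@[simp] theorem inrW_apply (g₂ : 𝕎₂ ≃ₗ[K] 𝕎₂) (v : 𝕎) :
    inrW e g₂ v = (glue e (resL e v.1) (g₂ (resR e v.1, resR e v.2)).1, glue e (resL e v.2) (g₂ (resR e v.1, resR e v.2)).2) :=
  rfl

/-- on glued vectors: `(1 ⊕ g₂)(a ⊔ a', b ⊔ b') = (a ⊔ (g₂(a', b')).1, b ⊔ (g₂(a', b')).2)`. [cite: Kudla1984, §1] -/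
theorem inrW_apply_glue (g₂ : 𝕎₂ ≃ₗ[K] 𝕎₂) (a b : ι₁ → K) (a' b' : ι₂ → K) :
    inrW e g₂ (glue e a a', glue e b b') = (glue e a (g₂ (a', b')).1, glue e b (g₂ (a', b')).2) := by
  simp only [inrW_apply, resL_glue, resR_glue]

/-- `1 ⊕ 1 = 1`. [cite: Kudla1984, §1] -/
theorem inrW_one : inrW (K := K) e (1 : 𝕎₂ ≃ₗ[K] 𝕎₂) = 1 :=
  LinearEquiv.ext fun v => by simp only [inrW_apply, LinearEquiv.coe_one, id_eq, glue_resL_resR, Prod.mk.eta]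

/-- `1 ⊕ (g₂ g₂') = (1 ⊕ g₂)(1 ⊕ g₂')`. [cite: Kudla1984, §1] -/
theorem inrW_mul (g₂ g₂' : 𝕎₂ ≃ₗ[K] 𝕎₂) : inrW e (g₂ * g₂') = inrW e g₂ * inrW e g₂' :=
  LinearEquiv.ext fun v => by
    simp only [inrW_apply, LinearEquiv.mul_apply, resL_glue, resR_glue, Prod.mk.eta]

/-- `(g₁ ⊕ 1)(1 ⊕ g₂) = (1 ⊕ g₂)(g₁ ⊕ 1)`: the two summands commute. [cite: Kudla1984, §1] -/
theorem inlW_mul_inrW_comm (g₁ : 𝕎₁ ≃ₗ[K] 𝕎₁) (g₂ : 𝕎₂ ≃ₗ[K] 𝕎₂) :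
    inlW e g₁ * inrW e g₂ = inrW e g₂ * inlW e g₁ :=
  LinearEquiv.ext fun v => by
    simp only [LinearEquiv.mul_apply, inlW_apply, inrW_apply, resL_glue, resR_glue]

end Blocks

section Algebra

variable {K : Type*} [CommRing K] {ι₁ ι₂ ι : Type*} [Fintype ι₁] [Fintype ι₂] [Fintype ι]
  [DecidableEq ι₁] [DecidableEq ι₂] [DecidableEq ι]
  (e : ι₁ ⊕ ι₂ ≃ ι) (T₁ : Matrix ι₁ ι₁ K) (T₂ : Matrix ι₂ ι₂ K) {T : Matrix ι ι K}
  (hT : T = Matrix.reindex e e (Matrix.fromBlocks T₁ 0 0 T₂))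

local notation "𝕎" => ((ι → K) × (ι → K))
local notation "𝕎₁" => ((ι₁ → K) × (ι₁ → K))
local notation "𝕎₂" => ((ι₂ → K) × (ι₂ → K))

include hT in
/-- **`1 ⊕ g₂` is symplectic for `β_T` when `g₂` is symplectic for `β_{T₂}`.** [cite: Kudla1984, §1] -/
theorem inrW_mem {g₂ : 𝕎₂ ≃ₗ[K] 𝕎₂} (hg₂ : g₂ ∈ symplecticGroup (polar (Matrix.toLinearMap₂' K T₂))) :
    inrW e g₂ ∈ symplecticGroup (polar (Matrix.toLinearMap₂' K T)) := by
  rw [mem_symplecticGroup] at hg₂ ⊢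
  intro v w
  have h1 := hg₂ (resR e v.1, resR e v.2) (resR e w.1, resR e w.2)
  simp only [polar_apply] at h1
  simp only [polar_apply, inrW_apply, toLinearMap₂'_glue e T₁ T₂ hT, toLinearMap₂'_blocks e T₁ T₂ hT v.1 w.2,
    toLinearMap₂'_blocks e T₁ T₂ hT w.1 v.2]
  linear_combination h1

/-- **`Sp(W_{T₂}) →* Sp(W_T)`, `g₂ ↦ 1 ⊕ g₂`** (through `e`) — the second summand of the see-saw pair
`Sp(W₁) × Sp(W₂) ⊂ Sp(W₁ ⊕ W₂)`. [cite: Kudla1984, §1] -/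
def spInr : symplecticGroup (polar (Matrix.toLinearMap₂' K T₂)) →* symplecticGroup (polar (Matrix.toLinearMap₂' K T)) where
  toFun g₂ := ⟨inrW e (g₂ : 𝕎₂ ≃ₗ[K] 𝕎₂), inrW_mem e T₁ T₂ hT g₂.2⟩
  map_one' := Subtype.ext (inrW_one e)
  map_mul' g g' := Subtype.ext (inrW_mul e g.1 g'.1)

/-- `spInr g₂ = 1 ⊕ g₂` as an automorphism. [cite: Kudla1984, §1] -/
@[simp] theorem coe_spInr (g₂ : symplecticGroup (polar (Matrix.toLinearMap₂' K T₂))) :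
    ((spInr e T₁ T₂ hT g₂ : symplecticGroup (polar (Matrix.toLinearMap₂' K T))) : 𝕎 ≃ₗ[K] 𝕎) =
      inrW e (g₂ : 𝕎₂ ≃ₗ[K] 𝕎₂) := rfl

/-- `g₂ ↦ 1 ⊕ g₂` is injective. [cite: Kudla1984, §1] -/
theorem spInr_injective : Function.Injective (spInr e T₁ T₂ hT) := by
  intro g g' h
  have h' : inrW e (g : 𝕎₂ ≃ₗ[K] 𝕎₂) = inrW e (g' : 𝕎₂ ≃ₗ[K] 𝕎₂) := congrArg Subtype.val h
  refine Subtype.ext (LinearEquiv.ext fun w => ?_)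
  have := congrArg (fun G : 𝕎 ≃ₗ[K] 𝕎 => splitW e (G (glue e 0 w.1, glue e 0 w.2))) h'
  simp only [inrW_apply_glue, splitW_apply, resL_glue, resR_glue, Prod.mk.injEq] at this
  exact Prod.ext this.2.1 this.2.2

/-- **the two embedded summands commute in `Sp(W_T)`**: `(g₁ ⊕ 1)(1 ⊕ g₂) = (1 ⊕ g₂)(g₁ ⊕ 1)`. [cite: Kudla1984, §1] -/
theorem spInl_mul_spInr_comm (g₁ : symplecticGroup (polar (Matrix.toLinearMap₂' K T₁)))
    (g₂ : symplecticGroup (polar (Matrix.toLinearMap₂' K T₂))) :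
    spInl e T₁ T₂ hT g₁ * spInr e T₁ T₂ hT g₂ = spInr e T₁ T₂ hT g₂ * spInl e T₁ T₂ hT g₁ :=
  Subtype.ext (inlW_mul_inrW_comm e g₁.1 g₂.1)

variable [Invertible (2 : K)]

/-- **`(1 ⊕ g₂) · inrH h₂ = inrH (g₂ · h₂)`** for Weil's section `ofSymplectic`. [cite: Weil1964, Chap. I n° 5 pp. 150–151] -/
theorem act_spInr_inrH (g₂ : symplecticGroup (polar (Matrix.toLinearMap₂' K T₂)))
    (h₂ : Heisenberg (polar (Matrix.toLinearMap₂' K T₂))) :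
    (ofSymplectic _ (spInr e T₁ T₂ hT g₂)).act (inrH e T₁ T₂ hT h₂) =
      inrH e T₁ T₂ hT ((ofSymplectic _ g₂).act h₂) := by
  apply Heisenberg.ext
  · simp only [Heisenberg.PseudoSymplectic.act_v, ofSymplectic_σ, inrH_v, coe_spInr, inrW_apply_glue, Prod.mk.eta]
  · simp only [Heisenberg.PseudoSymplectic.act_t, ofSymplectic_f, inrH_t, inrH_v, coe_spInr, inrW_apply_glue,
      polar_apply, toLinearMap₂'_glue e T₁ T₂ hT, map_zero, zero_add, Prod.mk.eta]

/-- **`(1 ⊕ g₂) · inlH h₁ = inlH h₁`**: the second summand fixes the Heisenberg group of the first.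
[cite: Weil1964, Chap. I n° 5 pp. 150–151] -/
theorem act_spInr_inlH (g₂ : symplecticGroup (polar (Matrix.toLinearMap₂' K T₂)))
    (h₁ : Heisenberg (polar (Matrix.toLinearMap₂' K T₁))) :
    (ofSymplectic _ (spInr e T₁ T₂ hT g₂)).act (inlH e T₁ T₂ hT h₁) = inlH e T₁ T₂ hT h₁ := by
  apply Heisenberg.ext
  · simp only [Heisenberg.PseudoSymplectic.act_v, ofSymplectic_σ, inlH_v, coe_spInr, inrW_apply_glue,
      Prod.mk_zero_zero, map_zero, Prod.fst_zero, Prod.snd_zero]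
  · simp only [Heisenberg.PseudoSymplectic.act_t, ofSymplectic_f, inlH_t, inlH_v, coe_spInr, inrW_apply_glue,
      polar_apply, toLinearMap₂'_glue e T₁ T₂ hT, Prod.mk_zero_zero, map_zero, Prod.fst_zero, Prod.snd_zero,
      sub_self, mul_zero, add_zero]

end Algebra

/-! ## §2 Stripping an implementer of `1 ⊕ g₂` -/

section Strip

variable {K : Type*} [Field K] [ValuativeRel K] [TopologicalSpace K] [IsNonarchimedeanLocalField K]
  [Invertible (2 : K)] {ι₁ ι₂ ι : Type*} [Fintype ι₁] [Fintype ι₂] [Fintype ι]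
  [DecidableEq ι₁] [DecidableEq ι₂] [DecidableEq ι]
  (e : ι₁ ⊕ ι₂ ≃ ι) (T₁ : Matrix ι₁ ι₁ K) (T₂ : Matrix ι₂ ι₂ K) {T : Matrix ι ι K}
  (hT : T = Matrix.reindex e e (Matrix.fromBlocks T₁ 0 0 T₂)) (hT₁ : IsUnit T₁.det) (hT₂ : IsUnit T₂.det)
  {ψ : AddChar K Circle} (hl : IsLocallyConstant (⇑ψ : K → Circle)) (hψ : ψ.IsContinuousNontrivial)
  (hb₁ : ∀ y : ι₁ → K, Continuous fun u : ι₁ → K => Matrix.toLinearMap₂' K T₁ u y)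
  (hb₂ : ∀ y : ι₂ → K, Continuous fun u : ι₂ → K => Matrix.toLinearMap₂' K T₂ u y)
  (hb : ∀ y : ι → K, Continuous fun u : ι → K => Matrix.toLinearMap₂' K T u y)

local notation "SB" => SchwartzBruhat (ι → K)
local notation "SB₁" => SchwartzBruhat (ι₁ → K)
local notation "SB₂" => SchwartzBruhat (ι₂ → K)
local notation "ρT" => schrodingerSB (Matrix.toLinearMap₂' K T) ψ hl hb
local notation "ρ₁" => schrodingerSB (Matrix.toLinearMap₂' K T₁) ψ hl hb₁
local notation "ρ₂" => schrodingerSB (Matrix.toLinearMap₂' K T₂) ψ hl hb₂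
local notation "Sp₁" => symplecticGroup (polar (Matrix.toLinearMap₂' K T₁))
local notation "Sp₂" => symplecticGroup (polar (Matrix.toLinearMap₂' K T₂))
local notation "SpT" => symplecticGroup (polar (Matrix.toLinearMap₂' K T))

include hT₁ hψ hb₁ in
/-- **an implementer of `1 ⊕ g₂` is `1 ⊠ B₂` on products**: it commutes with `ρ_T(inlH h₁) = ρ_{T₁}(h₁) ⊠ 1`
(`(1 ⊕ g₂) · inlH h₁ = inlH h₁`), whose commutant is `1 ⊠ End 𝒮(K^{ι₂})` by Schur for `ρ_{T₁}` (`det T₁` a unit)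
and the algebraic tensor-commutant lemma. [cite: MoeglinVignerasWaldspurger1987, Chap. 2 II.1 Rem. (6)] -/
theorem exists_strip_boxSB_right {g₂ : Sp₂} {M : SB ≃ₗ[ℂ] SB}
    (hM : Implements ρT (ofSymplectic _ (spInr e T₁ T₂ hT g₂)) M) :
    ∃ B₂ : SB₂ →ₗ[ℂ] SB₂, ∀ (f₁ : SB₁) (f₂ : SB₂), M (boxSB K e f₁ f₂) = boxSB K e f₁ (B₂ f₂) := by
  -- the operator read on the algebraic tensor product
  obtain ⟨T', hT'app⟩ : ∃ T' : SB₁ ⊗[ℂ] SB₂ →ₗ[ℂ] SB₁ ⊗[ℂ] SB₂,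
      ∀ z, T' z = (sumEquivSB K e).symm (M (sumEquivSB K e z)) :=
    ⟨(sumEquivSB K e).symm.toLinearMap ∘ₗ (M : SB →ₗ[ℂ] SB) ∘ₗ (sumEquivSB K e).toLinearMap, fun z => rfl⟩
  -- `M` commutes with `ρ_T(inlH h₁) = ρ₁(h₁) ⊠ 1`
  have hcommM : ∀ (h₁ : Heisenberg (polar (Matrix.toLinearMap₂' K T₁))) (Φ : SB),
      M (sumEndSB K e (ρ₁ h₁) LinearMap.id Φ) = sumEndSB K e (ρ₁ h₁) LinearMap.id (M Φ) := fun h₁ Φ => by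
    rw [← schrodingerSB_inlH_eq_sumEndSB e T₁ T₂ hT hl hb₁ hb, hM, act_spInr_inlH]
  have hrT : ∀ (h₁ : Heisenberg (polar (Matrix.toLinearMap₂' K T₁))) (w : SB₁ ⊗[ℂ] SB₂),
      LinearMap.rTensor SB₂ (ρ₁ h₁) w = (sumEquivSB K e).symm (sumEndSB K e (ρ₁ h₁) LinearMap.id (sumEquivSB K e w)) :=
    fun h₁ w => by rw [sumEquivSB_symm_sumEndSB, LinearEquiv.symm_apply_apply]; rfl
  have hcomm : ∀ s ∈ Set.range (fun h₁ : Heisenberg (polar (Matrix.toLinearMap₂' K T₁)) => ρ₁ h₁),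
      T' ∘ₗ LinearMap.rTensor SB₂ s = LinearMap.rTensor SB₂ s ∘ₗ T' := by
    rintro _ ⟨h₁, rfl⟩
    refine LinearMap.ext fun z => ?_
    rw [LinearMap.comp_apply, LinearMap.comp_apply, hT'app, hT'app, hrT, hrT, LinearEquiv.apply_symm_apply,
      LinearEquiv.apply_symm_apply, hcommM]
  -- Schur for the first factor, then the tensor-commutant lemma
  have hS : ∀ C : SB₁ →ₗ[ℂ] SB₁,
      (∀ s ∈ Set.range (fun h₁ : Heisenberg (polar (Matrix.toLinearMap₂' K T₁)) => ρ₁ h₁), C ∘ₗ s = s ∘ₗ C) →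
        ∃ c : ℂ, C = c • LinearMap.id := fun C hC => by
    obtain ⟨c, hc⟩ := commutant_schrodingerSB_gram T₁ hT₁ hl hb₁ hψ C fun h₁ f =>
      LinearMap.congr_fun (hC _ ⟨h₁, rfl⟩) f
    exact ⟨c, LinearMap.ext fun f => by rw [hc, LinearMap.smul_apply, LinearMap.id_apply]⟩
  obtain ⟨B₂, hB₂⟩ := exists_tmul_eq_of_commute_rTensor hS T' hcomm
  refine ⟨B₂, fun f₁ f₂ => ?_⟩
  have h := hB₂ f₁ f₂
  rw [hT'app, LinearEquiv.symm_apply_eq] at h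
  exact h

include hT₁ hψ hb₁ in
/-- **SUM-STRIPPING AT A FINITE PLACE, RIGHT SUMMAND.** Let `(G, M) ∈ S̃p_ψ(W_T)` lie over `G = 1 ⊕ g₂`. Then there
is `(g₂, M₂) ∈ S̃p_ψ(W_{T₂})` — an implementer of `g₂` on `𝒮(K^{ι₂})` — with `M (f₁ ⊠ f₂) = f₁ ⊠ M₂ f₂` for all
`f₁, f₂`: the restriction of the metaplectic representation of `W_{T₁} ⊕ W_{T₂}` to the second summand is `1 ⊠ ω₂`.
[cite: MoeglinVignerasWaldspurger1987, Chap. 2 II.1 Rem. (6); Weil1964, Chap. III n° 37–38 pp. 188–190] -/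
theorem exists_strip_of_proj_eq_spInr (p : MpPsi ρT) (g₂ : Sp₂)
    (hG : (p : SpT × (SB ≃ₗ[ℂ] SB)).1 = spInr e T₁ T₂ hT g₂) :
    ∃ p₂ : MpPsi ρ₂, (p₂ : Sp₂ × (SB₂ ≃ₗ[ℂ] SB₂)).1 = g₂ ∧
      ∀ (f₁ : SB₁) (f₂ : SB₂), (p : SpT × (SB ≃ₗ[ℂ] SB)).2 (boxSB K e f₁ f₂) =
        boxSB K e f₁ ((p₂ : Sp₂ × (SB₂ ≃ₗ[ℂ] SB₂)).2 f₂) := by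
  have hImp : Implements ρT (ofSymplectic _ (spInr e T₁ T₂ hT g₂)) (p : SpT × (SB ≃ₗ[ℂ] SB)).2 := by
    have h := (mem_MpPsi _ _).1 p.2
    rwa [hG] at h
  have hImp' : Implements ρT (ofSymplectic _ (spInr e T₁ T₂ hT g₂⁻¹)) ((p⁻¹ : MpPsi ρT) : SpT × (SB ≃ₗ[ℂ] SB)).2 := by
    have h := (mem_MpPsi _ _).1 (p⁻¹).2
    rwa [Subgroup.coe_inv, Prod.fst_inv, hG, ← map_inv] at h
  obtain ⟨N, hN⟩ := exists_strip_boxSB_right e T₁ T₂ hT hT₁ hl hψ hb₁ hb hImp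
  obtain ⟨N', hN'⟩ := exists_strip_boxSB_right e T₁ T₂ hT hT₁ hl hψ hb₁ hb hImp'
  obtain ⟨f₁, hf₁⟩ := exists_schwartzBruhat_pi_ne_zero K ι₁
  -- `M⁻¹ M = 1 = M M⁻¹` strip to `N' N = 1 = N N'`
  have h₁ : N' ∘ₗ N = LinearMap.id := by
    refine LinearMap.ext fun f₂ => boxSB_right_cancel K e hf₁ ?_
    rw [LinearMap.comp_apply, LinearMap.id_apply, ← hN', ← hN, ← LinearEquiv.mul_apply, ← Prod.snd_mul,
      ← Subgroup.coe_mul, inv_mul_cancel, OneMemClass.coe_one, Prod.snd_one, LinearEquiv.coe_one, id_eq]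
  have h₂ : N ∘ₗ N' = LinearMap.id := by
    refine LinearMap.ext fun f₂ => boxSB_right_cancel K e hf₁ ?_
    rw [LinearMap.comp_apply, LinearMap.id_apply, ← hN, ← hN', ← LinearEquiv.mul_apply, ← Prod.snd_mul,
      ← Subgroup.coe_mul, mul_inv_cancel, OneMemClass.coe_one, Prod.snd_one, LinearEquiv.coe_one, id_eq]
  let M₂ : SB₂ ≃ₗ[ℂ] SB₂ := LinearEquiv.ofLinear N N' h₂ h₁
  -- `(g₂, M₂)` implements `g₂` on `H(W_{T₂})`
  have hmem : ((g₂, M₂) : Sp₂ × (SB₂ ≃ₗ[ℂ] SB₂)) ∈ MpPsi ρ₂ := by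
    rw [mem_MpPsi]
    intro h₂ f₂
    refine boxSB_right_cancel K e hf₁ ?_
    change boxSB K e f₁ (N (ρ₂ h₂ f₂)) = boxSB K e f₁ (ρ₂ ((ofSymplectic _ g₂).act h₂) (N f₂))
    rw [← hN, ← schrodingerSB_inrH_boxSB e T₁ T₂ hT hl hb₂ hb, hImp, act_spInr_inrH, hN,
      schrodingerSB_inrH_boxSB e T₁ T₂ hT hl hb₂ hb]
  exact ⟨⟨(g₂, M₂), hmem⟩, rfl, fun f₁' f₂ => hN f₁' f₂⟩

omit [Invertible (2 : K)] [DecidableEq ι₁] [DecidableEq ι₂] [DecidableEq ι] in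
/-- **uniqueness of the stripped operator**: `M₂` is determined by `M (f₁ ⊠ f₂) = f₁ ⊠ M₂ f₂` for one `f₁ ≠ 0`.
[cite: MoeglinVignerasWaldspurger1987, Chap. 2 II.1 Rem. (6)] -/
theorem strip_unique_right {M₂ M₂' : SB₂ →ₗ[ℂ] SB₂} {f₁ : SB₁} (hf₁ : f₁ ≠ 0)
    (h : ∀ f₂ : SB₂, boxSB K e f₁ (M₂ f₂) = boxSB K e f₁ (M₂' f₂)) : M₂ = M₂' :=
  LinearMap.ext fun f₂ => boxSB_right_cancel K e hf₁ (h f₂)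

/-! ## §3 Box implementers of `(g₁ ⊕ 1)(1 ⊕ g₂)` -/

include hT in
omit [ValuativeRel K] [TopologicalSpace K] [IsNonarchimedeanLocalField K] [Invertible (2 : K)] in
/-- `det T = det T₁ · det T₂` is a unit when both blocks are. [cite: Kudla1984, §1] -/
theorem isUnit_det_of_blocks (hT₁ : IsUnit T₁.det) (hT₂ : IsUnit T₂.det) : IsUnit T.det := by
  rw [hT, Matrix.det_reindex_self, Matrix.det_fromBlocks_zero₂₁]
  exact hT₁.mul hT₂

/-- On the first Heisenberg summand: `M ρ_T(inlH h₁) = ρ_T(((g₁ ⊕ 1)(1 ⊕ g₂)) · inlH h₁) M` for `M = M₁ ⊠ M₂`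
on products (as linear maps; `(1 ⊕ g₂)` fixes `inlH h₁`, `(g₁ ⊕ 1)` acts through `g₁`).
[cite: MoeglinVignerasWaldspurger1987, Chap. 2 II.1 Rem. (6)] -/
theorem comp_schrodingerSB_inlH_of_boxSB (g₁ : Sp₁) (g₂ : Sp₂) {M₁ : SB₁ ≃ₗ[ℂ] SB₁} {M₂ : SB₂ ≃ₗ[ℂ] SB₂}
    (hM₁ : Implements ρ₁ (ofSymplectic _ g₁) M₁) {M : SB ≃ₗ[ℂ] SB}
    (hM : ∀ (f₁ : SB₁) (f₂ : SB₂), M (boxSB K e f₁ f₂) = boxSB K e (M₁ f₁) (M₂ f₂))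
    (h₁ : Heisenberg (polar (Matrix.toLinearMap₂' K T₁))) :
    (M : SB →ₗ[ℂ] SB) ∘ₗ ρT (inlH e T₁ T₂ hT h₁) =
      ρT ((ofSymplectic _ (spInl e T₁ T₂ hT g₁ * spInr e T₁ T₂ hT g₂)).act (inlH e T₁ T₂ hT h₁)) ∘ₗ
        (M : SB →ₗ[ℂ] SB) := by
  apply linearMap_ext_boxSB K e
  intro f₁ f₂
  rw [LinearMap.comp_apply, LinearMap.comp_apply, LinearEquiv.coe_coe, map_mul,
    Heisenberg.PseudoSymplectic.act_mul_act, act_spInr_inlH, act_spInl_inlH,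
    schrodingerSB_inlH_boxSB e T₁ T₂ hT hl hb₁ hb, hM, hM, schrodingerSB_inlH_boxSB e T₁ T₂ hT hl hb₁ hb, hM₁]

/-- On the second Heisenberg summand: `M ρ_T(inrH h₂) = ρ_T(((g₁ ⊕ 1)(1 ⊕ g₂)) · inrH h₂) M` for `M = M₁ ⊠ M₂`
on products. [cite: MoeglinVignerasWaldspurger1987, Chap. 2 II.1 Rem. (6)] -/
theorem comp_schrodingerSB_inrH_of_boxSB (g₁ : Sp₁) (g₂ : Sp₂) {M₁ : SB₁ ≃ₗ[ℂ] SB₁} {M₂ : SB₂ ≃ₗ[ℂ] SB₂}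
    (hM₂ : Implements ρ₂ (ofSymplectic _ g₂) M₂) {M : SB ≃ₗ[ℂ] SB}
    (hM : ∀ (f₁ : SB₁) (f₂ : SB₂), M (boxSB K e f₁ f₂) = boxSB K e (M₁ f₁) (M₂ f₂))
    (h₂ : Heisenberg (polar (Matrix.toLinearMap₂' K T₂))) :
    (M : SB →ₗ[ℂ] SB) ∘ₗ ρT (inrH e T₁ T₂ hT h₂) =
      ρT ((ofSymplectic _ (spInl e T₁ T₂ hT g₁ * spInr e T₁ T₂ hT g₂)).act (inrH e T₁ T₂ hT h₂)) ∘ₗ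
        (M : SB →ₗ[ℂ] SB) := by
  apply linearMap_ext_boxSB K e
  intro f₁ f₂
  rw [LinearMap.comp_apply, LinearMap.comp_apply, LinearEquiv.coe_coe, map_mul,
    Heisenberg.PseudoSymplectic.act_mul_act, act_spInr_inrH, act_spInl_inrH,
    schrodingerSB_inrH_boxSB e T₁ T₂ hT hl hb₂ hb, hM, hM, schrodingerSB_inrH_boxSB e T₁ T₂ hT hl hb₂ hb, hM₂]

/-- **`M₁ ⊠ M₂` implements `(g₁ ⊕ 1)(1 ⊕ g₂)`**: if `M₁` implements `g₁` for `ρ_{T₁}` and `M₂` implements `g₂` for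
`ρ_{T₂}`, every linear automorphism `M` of `𝒮(K^ι)` with `M (f₁ ⊠ f₂) = M₁ f₁ ⊠ M₂ f₂` implements
`spInl g₁ · spInr g₂` for `ρ_T` (check on the generators `inlH h₁`, `inrH h₂` of `H(W_T)`, every element being
`inlH(h|₁) · inrH(h|₂, 0)`). [cite: MoeglinVignerasWaldspurger1987, Chap. 2 II.1 Rem. (6)] -/
theorem implements_of_boxSB (g₁ : Sp₁) (g₂ : Sp₂) {M₁ : SB₁ ≃ₗ[ℂ] SB₁} {M₂ : SB₂ ≃ₗ[ℂ] SB₂}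
    (hM₁ : Implements ρ₁ (ofSymplectic _ g₁) M₁) (hM₂ : Implements ρ₂ (ofSymplectic _ g₂) M₂) {M : SB ≃ₗ[ℂ] SB}
    (hM : ∀ (f₁ : SB₁) (f₂ : SB₂), M (boxSB K e f₁ f₂) = boxSB K e (M₁ f₁) (M₂ f₂)) :
    Implements ρT (ofSymplectic _ (spInl e T₁ T₂ hT g₁ * spInr e T₁ T₂ hT g₂)) M := by
  intro h Φ
  have hA := LinearMap.congr_fun (comp_schrodingerSB_inlH_of_boxSB e T₁ T₂ hT hl hb₁ hb g₁ g₂ hM₁ hM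
    (fstH e T₁ h)) (ρT (inrH e T₁ T₂ hT (sndH e T₂ h)) Φ)
  have hB := LinearMap.congr_fun (comp_schrodingerSB_inrH_of_boxSB e T₁ T₂ hT hl hb₂ hb g₁ g₂ hM₂ hM
    (sndH e T₂ h)) Φ
  simp only [LinearMap.comp_apply, LinearEquiv.coe_coe] at hA hB
  rw [← inlH_fstH_mul_inrH_sndH e T₁ T₂ hT h, map_mul ρT, Heisenberg.PseudoSymplectic.act_mul, map_mul ρT,
    Module.End.mul_apply, Module.End.mul_apply, hA, hB]

include hT₁ hT₂ hψ in
/-- **BOX IMPLEMENTERS.** Let `(g₁, M₁) ∈ S̃p_ψ(W_{T₁})` and `(g₂, M₂) ∈ S̃p_ψ(W_{T₂})` (`det T₁`, `det T₂` units). Then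
every implementer `M` of `(g₁ ⊕ 1)(1 ⊕ g₂)` for `ρ_T` is `M₁ ⊠ M₂` up to a unit scalar:
`M (f₁ ⊠ f₂) = c · (M₁ f₁ ⊠ M₂ f₂)` for all `f₁, f₂` (`M₁ ⊠ M₂` is an implementer, `implements_of_boxSB`, and
implementers of `ρ_T` are unique up to scalars, `det T = det T₁ det T₂` being a unit).
[cite: MoeglinVignerasWaldspurger1987, Chap. 2 II.1 (A) and Rem. (6)] -/
theorem exists_smul_boxSB_of_implements_mul (g₁ : Sp₁) (g₂ : Sp₂) {M₁ : SB₁ ≃ₗ[ℂ] SB₁} {M₂ : SB₂ ≃ₗ[ℂ] SB₂}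
    (hM₁ : Implements ρ₁ (ofSymplectic _ g₁) M₁) (hM₂ : Implements ρ₂ (ofSymplectic _ g₂) M₂) {M : SB ≃ₗ[ℂ] SB}
    (hM : Implements ρT (ofSymplectic _ (spInl e T₁ T₂ hT g₁ * spInr e T₁ T₂ hT g₂)) M) :
    ∃ c : ℂˣ, ∀ (f₁ : SB₁) (f₂ : SB₂), M (boxSB K e f₁ f₂) = (c : ℂ) • boxSB K e (M₁ f₁) (M₂ f₂) := by
  -- `M' = M₁ ⊠ M₂` as a linear automorphism of `𝒮(K^ι)`
  have h1 : sumEndSB K e (M₁ : SB₁ →ₗ[ℂ] SB₁) (M₂ : SB₂ →ₗ[ℂ] SB₂) ∘ₗ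
      sumEndSB K e (M₁.symm : SB₁ →ₗ[ℂ] SB₁) (M₂.symm : SB₂ →ₗ[ℂ] SB₂) = LinearMap.id := by
    rw [← sumEndSB_comp, ← sumEndSB_id K e]
    congr 1 <;> exact LinearMap.ext fun x => by simp
  have h2 : sumEndSB K e (M₁.symm : SB₁ →ₗ[ℂ] SB₁) (M₂.symm : SB₂ →ₗ[ℂ] SB₂) ∘ₗ
      sumEndSB K e (M₁ : SB₁ →ₗ[ℂ] SB₁) (M₂ : SB₂ →ₗ[ℂ] SB₂) = LinearMap.id := by
    rw [← sumEndSB_comp, ← sumEndSB_id K e]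
    congr 1 <;> exact LinearMap.ext fun x => by simp
  let M' : SB ≃ₗ[ℂ] SB := LinearEquiv.ofLinear _ _ h1 h2
  have hM' : ∀ (f₁ : SB₁) (f₂ : SB₂), M' (boxSB K e f₁ f₂) = boxSB K e (M₁ f₁) (M₂ f₂) := fun f₁ f₂ =>
    sumEndSB_boxSB K e _ _ f₁ f₂
  have hImp' := implements_of_boxSB e T₁ T₂ hT hl hb₁ hb₂ hb g₁ g₂ hM₁ hM₂ hM'
  obtain ⟨c, hc⟩ := implementerUniqueUpToScalar_schrodingerSB_gram T (isUnit_det_of_blocks e T₁ T₂ hT hT₁ hT₂) hl hb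
    hψ _ M' M hImp' hM
  exact ⟨c, fun f₁ f₂ => by rw [hc, hM']⟩

end Strip

end Literature.RepresentationTheory.HeisenbergGroup

end
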